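import Summits.CriticalPhenomena.SAWScalingLimit.Theses.SAWExcursionCardy
import Summits.CriticalPhenomena.SAWScalingLimit.Theorems.SAWLoopFugacityFlowSimpleSubseqLimitsFarReturnLine
import Summits.CriticalPhenomena.SAWScalingLimit.Theorems.SAWLoopFugacityFlowSimpleSubseqLimitsBoundaryPassage
import HarnessLib

/-!
# Lattice split of crux `SimpleSubseqLimits` (stmt-CriticalPhenomena-4514) on route `SAWExcursionCardy`:
ORDER child `LatticeFarReturnDecay` ∧ BOUNDARY child `LatticeBoundaryDecay` ⇒ the crux (PROVED glue)

Route `SAWExcursionCardy` of `CriticalPhenomena/SAWScalingLimit` (crux rank 5, shared verbatim by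
`SAWQuadrupoleWard`, `SAWStressTensor`). The crux

`SimpleSubseqLimits := ∀ D a b, IsEndpointApprox D a b → ∀ s μ, s → 0⁺ → IsProbabilityMeasure μ →
  (∀ f : CurveClass ℂ →ᵇ ℝ, ∫ f ∘ curve dP_{s n} → ∫ f dμ) → μ-a.e. γ, γ ∈ simple ∧ γ.range ∩ ∂D ⊆ {a, b}`

is split into its two LATTICE inputs, each a `δ`-uniform smallness statement for an OPEN event of
the critical `δℤ²` self-avoiding walk under `SAW.law` (weight `x_c^{|γ|}`), along every endpoint
approximation:

* ORDER child `LatticeFarReturnDecay` — FIRST-ENTRANCE FAR-RETURN DECAY: for every closed ball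
  `B̄(q, r)` and target `θ > 0` there are a width `ε > 0` and radii `0 < r₀ < r < r'` such that,
  eventually as `δ → 0⁺`, with probability `≤ θ` some representative of the walk's curve class has
  times `v < T ≤ t'` with the curve outside the guard ball `B̄(q, 5r)` on `[0, v]`, outside `B̄(q, r₀)`
  on `[0, T]`, inside `B(q, r')` at `T` and `ε`-close to `γ v` at `t'` — verbatim
  `FarPast.Passage.FarReturnDecay` with its vocabulary inlined (`latticeFarReturnDecay_iff`, `Iff.rfl`);
* BOUNDARY child `LatticeBoundaryDecay` — NO BOUNDARY CRAWLING: for every separation `ρ > 0` and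
  `θ > 0` there is `ε > 0` such that, eventually, with probability `≤ θ` some representative visits
  the open `ε`-neighbourhood of `∂D` at a point `ρ`-far from both marked points — verbatim
  `Boundary.Passage.BoundaryDecay` inlined (`latticeBoundaryDecay_iff`, `Iff.rfl`).

Both texts are written with FULLY QUALIFIED names, exactly as they are filed as the children's route
items (`ledger route edit route-CriticalPhenomena-SAWExcursionCardy --split SimpleSubseqLimits …
--glue-by …SimpleSubseqLimits_of_latticeSubs`).

## The glue (PROVED, no `sorry`): `SimpleSubseqLimits_of_latticeSubs`

`LatticeFarReturnDecay → LatticeBoundaryDecay → SAWExcursionCardy.SimpleSubseqLimits`, concluded BY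
NAME: for `(D, a, b)` with `IsEndpointApprox`, a mesh sequence `s → 0⁺` and a weak limit `μ`, the ORDER
clause `μ`-a.e. by the landed passage `FarPast.Passage.ae_simple_of_farReturnDecayAt` (portmanteau on
the countably many OPEN thickened events ⇒ exact far returns are `μ`-null ⇒ guarded Rohde–Schramm
closing lemma), the BOUNDARY clause by `Boundary.Passage.ae_boundary_of_boundaryDecayAt` (same
mechanism on the near-boundary-visit events); the two a.e. statements are intersected. The seam is
not a one-liner, but it uses only landed theorems; no other route item enters.

## Certificates carried with the split (all PROVED here from landed theorems)

* `children_of_sawScalingLimit` — BOTH children are implied by the summit conjunct (they are not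
  over-strong; landed pins `FarPast.Line.farLattice_of_sawScalingLimit`);
* `crux_iff_children` — modulo eventual tightness of the critical SAW laws (in the sister routes'
  set-form typing `SAWLoopFugacityFlow.EventualTight`, stmt-1372; this route's own item stmt-1881 is
  the along-mesh form) the crux IS the conjunction of its two children
  (`FarPast.Line.crux_iff_farLattice` transported through `crux_iff_sister`): jointly they lose
  nothing, and neither child alone is the crux (the ORDER child says nothing about `∂D`, the BOUNDARY
  child nothing about double points; cheap probes `child → crux`, `child → SAWScalingLimit` fail, see
  the strategist's record `Cruxes/SimpleSubseqLimits/SPLIT-r1-lattice.md`).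

References: Lawler–Schramm–Werner, *On the scaling limit of planar self-avoiding walk*, Proc. Sympos.
Pure Math. 72 (2004) §3.4.5 (the heuristic "the walk avoids its past as it avoids the boundary");
Rohde–Schramm, Ann. Math. 161 (2005) (closing lemma pattern); Billingsley, *Convergence of probability
measures* (1999) Thm 2.1 (portmanteau); Kemppainen–Smirnov, Ann. Probab. 45 (2017) §1 (what a priori
estimates an interface needs).
-/

noncomputable section

open MeasureTheory Filter Topology Set Metric Function
open Literature.Probability.RandomPlanarGeometry Literature.Probability.RandomPlanarGeometry.SAW
open Literature.Probability.LatticeModels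
open scoped ENNReal NNReal BoundedContinuousFunction unitInterval

namespace Summit.CriticalPhenomena.SAWScalingLimit.Theorems.SimpleSubseqLimits.ExcursionCardyLatticeSplit

open Summit.CriticalPhenomena.SAWScalingLimit.Theorems.SimpleSubseqLimits.MarkedPointRevisit.Passage
  (IsSubseqLimit)
open Summit.CriticalPhenomena.SAWScalingLimit.Theorems.SimpleSubseqLimits.Negative
  (SimpleSubseqLimitsCore simpleSubseqLimits_iff_core)
open Summit.CriticalPhenomena.SAWScalingLimit.Theorems.SimpleSubseqLimits.Boundary.Passage
  (BoundaryDecay ae_boundary_of_boundaryDecayAt)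
open Summit.CriticalPhenomena.SAWScalingLimit.Theorems.SimpleSubseqLimits.FarPast.Passage
  (FarReturnDecay ae_simple_of_farReturnDecayAt)
open Summit.CriticalPhenomena.SAWScalingLimit.Theorems.SimpleSubseqLimits.FarPast.Line
  (farLattice_of_sawScalingLimit crux_iff_farLattice)

/-! ### The two children, in route-file vocabulary (fully qualified; these ARE the item texts) -/

/-- **ORDER child `LatticeFarReturnDecay`** (route item text, verbatim): first-entrance far-return
decay of the critical `δℤ²` SAW along every endpoint approximation. Untagged: an open statement of the
problem, not a literature fact. -/
def LatticeFarReturnDecay : Prop :=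
  ∀ (D : Literature.Probability.RandomPlanarGeometry.DobrushinDomain) (a b : ℝ → Literature.Probability.LatticeModels.Site 2), Literature.Probability.RandomPlanarGeometry.SAW.IsEndpointApprox D a b → ∀ (q : ℂ) (r θ : ℝ), 0 < r → 0 < θ → ∃ ε r₀ r' : ℝ, 0 < ε ∧ 0 < r₀ ∧ r₀ < r ∧ r < r' ∧ ∀ᶠ δ in nhdsWithin 0 (Set.Ioi 0), Literature.Probability.RandomPlanarGeometry.SAW.law D.carrier δ (a δ) (b δ) {γ | ∃ γ' : Literature.Probability.RandomPlanarGeometry.Curve ℂ, Literature.Probability.RandomPlanarGeometry.CurveClass.mk γ' = γ.curve ∧ ∃ v T t' : unitInterval, v < T ∧ T ≤ t' ∧ (∀ u : unitInterval, u ≤ v → 5 * r < dist (γ' u) q) ∧ (∀ u : unitInterval, u ≤ T → r₀ < dist (γ' u) q) ∧ dist (γ' T) q < r' ∧ dist (γ' t') (γ' v) < ε} ≤ ENNReal.ofReal θ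

/-- **BOUNDARY child `LatticeBoundaryDecay`** (route item text, verbatim): no boundary crawling of the
critical `δℤ²` SAW away from the marked points, along every endpoint approximation. Untagged. -/
def LatticeBoundaryDecay : Prop :=
  ∀ (D : Literature.Probability.RandomPlanarGeometry.DobrushinDomain) (a b : ℝ → Literature.Probability.LatticeModels.Site 2), Literature.Probability.RandomPlanarGeometry.SAW.IsEndpointApprox D a b → ∀ ρ θ : ℝ, 0 < ρ → 0 < θ → ∃ ε : ℝ, 0 < ε ∧ ∀ᶠ δ in nhdsWithin 0 (Set.Ioi 0), Literature.Probability.RandomPlanarGeometry.SAW.law D.carrier δ (a δ) (b δ) {γ | ∃ γ' : Literature.Probability.RandomPlanarGeometry.Curve ℂ, Literature.Probability.RandomPlanarGeometry.CurveClass.mk γ' = γ.curve ∧ ∃ t : unitInterval, Metric.infDist (γ' t) (frontier D.carrier) < ε ∧ ρ < dist (γ' t) (D.pt 0) ∧ ρ < dist (γ' t) (D.pt 1)} ≤ ENNReal.ofReal θ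

/-- The ORDER child IS `FarPast.Passage.FarReturnDecay` (definitional read-back). [folklore] -/
theorem latticeFarReturnDecay_iff : LatticeFarReturnDecay ↔ FarReturnDecay := Iff.rfl

/-- The BOUNDARY child IS `Boundary.Passage.BoundaryDecay` (definitional read-back). [folklore] -/
theorem latticeBoundaryDecay_iff : LatticeBoundaryDecay ↔ BoundaryDecay := Iff.rfl

/-! ### The glue: children ⇒ the crux, by name (PROVED) -/

/-- **GLUE OF THE LATTICE SPLIT (stmt-CriticalPhenomena-4514; registered stub
`SimpleSubseqLimits_of_latticeSubs`).** `LatticeFarReturnDecay → LatticeBoundaryDecay →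
SAWExcursionCardy.SimpleSubseqLimits`, the children written out verbatim (so that the type of this
theorem is literally `Child₁ → Child₂ → Parent` for `route edit --split … --glue-by`): the ORDER clause
`μ`-a.e. from far-return decay through `ae_simple_of_farReturnDecayAt`, the BOUNDARY clause from
boundary decay through `ae_boundary_of_boundaryDecayAt`, intersected. [folklore] -/
theorem SimpleSubseqLimits_of_latticeSubs :
    (∀ (D : Literature.Probability.RandomPlanarGeometry.DobrushinDomain) (a b : ℝ → Literature.Probability.LatticeModels.Site 2), Literature.Probability.RandomPlanarGeometry.SAW.IsEndpointApprox D a b → ∀ (q : ℂ) (r θ : ℝ), 0 < r → 0 < θ → ∃ ε r₀ r' : ℝ, 0 < ε ∧ 0 < r₀ ∧ r₀ < r ∧ r < r' ∧ ∀ᶠ δ in nhdsWithin 0 (Set.Ioi 0), Literature.Probability.RandomPlanarGeometry.SAW.law D.carrier δ (a δ) (b δ) {γ | ∃ γ' : Literature.Probability.RandomPlanarGeometry.Curve ℂ, Literature.Probability.RandomPlanarGeometry.CurveClass.mk γ' = γ.curve ∧ ∃ v T t' : unitInterval, v < T ∧ T ≤ t' ∧ (∀ u : unitInterval, u ≤ v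 → 5 * r < dist (γ' u) q) ∧ (∀ u : unitInterval, u ≤ T → r₀ < dist (γ' u) q) ∧ dist (γ' T) q < r' ∧ dist (γ' t') (γ' v) < ε} ≤ ENNReal.ofReal θ) →
    (∀ (D : Literature.Probability.RandomPlanarGeometry.DobrushinDomain) (a b : ℝ → Literature.Probability.LatticeModels.Site 2), Literature.Probability.RandomPlanarGeometry.SAW.IsEndpointApprox D a b → ∀ ρ θ : ℝ, 0 < ρ → 0 < θ → ∃ ε : ℝ, 0 < ε ∧ ∀ᶠ δ in nhdsWithin 0 (Set.Ioi 0), Literature.Probability.RandomPlanarGeometry.SAW.law D.carrier δ (a δ) (b δ) {γ | ∃ γ' : Literature.Probability.RandomPlanarGeometry.Curve ℂ, Literature.Probability.RandomPlanarGeometry.CurveClass.mk γ' = γ.curve ∧ ∃ t : unitInterval, Metric.infDist (γ' t) (frontier D.carrier) < ε ∧ ρ < dist (γ' t) (D.pt 0) ∧ ρ < dist (γ' t) (D.pt 1)} ≤ ENNReal.ofReal θ) →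
    Summit.CriticalPhenomena.SAWScalingLimit.Theses.SAWExcursionCardy.SimpleSubseqLimits := by
  intro hF hB D a b hab s μ hs hμ hw
  have hF' : FarReturnDecay := latticeFarReturnDecay_iff.1 hF
  have hB' : BoundaryDecay := latticeBoundaryDecay_iff.1 hB
  have hL : IsSubseqLimit D a b s μ := ⟨hs, hμ, hw⟩
  -- ORDER: μ-a.e. class is simple (far-return decay at (D; a_δ, b_δ) + the limit passage)
  have hsimple : ∀ᵐ c ∂μ, c ∈ CurveClass.simple :=
    ae_simple_of_farReturnDecayAt hab (hF' D a b hab) hL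
  -- BOUNDARY: μ-a.e. class meets ∂D only at the marked points (boundary decay + the limit passage)
  have hbd : ∀ᵐ c ∂μ, c.range ∩ frontier D.carrier ⊆ {D.pt 0, D.pt 1} :=
    ae_boundary_of_boundaryDecayAt (hB' D a b hab) hL
  filter_upwards [hsimple, hbd] with c h1 h2
  exact ⟨h1, h2⟩

/-- Named form of the glue. [folklore] -/
theorem simpleSubseqLimits_of_children (hF : LatticeFarReturnDecay) (hB : LatticeBoundaryDecay) :
    Summit.CriticalPhenomena.SAWScalingLimit.Theses.SAWExcursionCardy.SimpleSubseqLimits :=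
  SimpleSubseqLimits_of_latticeSubs hF hB

/-! ### Certificates: the children are summit-implied, and jointly equivalent to the crux modulo tightness -/

/-- **This crux IS the landed core of the sister item stmt-CriticalPhenomena-4982**
(`SAWExcursionCardy.SimpleSubseqLimits ↔ SAWLoopFugacityFlow.SimpleSubseqLimits`; our side is
`Negative.SimpleSubseqLimitsCore` verbatim, the sister side by `Negative.simpleSubseqLimits_iff_core`).
[folklore] -/
theorem crux_iff_sister :
    Summit.CriticalPhenomena.SAWScalingLimit.Theses.SAWExcursionCardy.SimpleSubseqLimits ↔
      Summit.CriticalPhenomena.SAWScalingLimit.Theses.SAWLoopFugacityFlow.SimpleSubseqLimits := by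
  have h : Summit.CriticalPhenomena.SAWScalingLimit.Theses.SAWExcursionCardy.SimpleSubseqLimits ↔
      SimpleSubseqLimitsCore := Iff.rfl
  exact h.trans simpleSubseqLimits_iff_core.symm

/-- **Both children are implied by the summit conjunct** `SAWScalingLimit` (neither is over-strong).
[folklore] -/
theorem children_of_sawScalingLimit (h : _root_.SAWScalingLimit) :
    LatticeFarReturnDecay ∧ LatticeBoundaryDecay :=
  farLattice_of_sawScalingLimit h

/-- **Modulo eventual tightness the crux IS the conjunction of its two children** (set-form tightness
`SAWLoopFugacityFlow.EventualTight`, stmt-CriticalPhenomena-1372, of the sister routes; this route's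
stmt-1881 is the along-mesh form): the split loses nothing. [folklore] -/
theorem crux_iff_children
    (hT : Summit.CriticalPhenomena.SAWScalingLimit.Theses.SAWLoopFugacityFlow.EventualTight) :
    Summit.CriticalPhenomena.SAWScalingLimit.Theses.SAWExcursionCardy.SimpleSubseqLimits ↔
      LatticeFarReturnDecay ∧ LatticeBoundaryDecay :=
  crux_iff_sister.trans (crux_iff_farLattice hT)

end Summit.CriticalPhenomena.SAWScalingLimit.Theorems.SimpleSubseqLimits.ExcursionCardyLatticeSplit

end
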